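import Mathlib
import HarnessLib
import Summits.NavierStokesRegularity.NavierStokesRegularity.Theorems.UnthreadedRigidityDoorUnthreadedRigidityVirialHornCertificate
import Summits.NavierStokesRegularity.NavierStokesRegularity.Theorems.UnthreadedRigidityDoorUnthreadedRigidityVirialHornPrimitiveArrays
import Summits.NavierStokesRegularity.NavierStokesRegularity.Theorems.ThreadingFluxLoopLawBracketSlotPair

/-!
# VIRIAL HORN, W-ii (5/6): SPAN OF THE COHERENT FRAME and THE BRACKET SUM OF AN ARRAY (equivariance, certificates)

Route `UnthreadedRigidityDoor`, item `UnthreadedRigidity` (W2, stmt-NavierStokesRegularity-27585) — LINE g11-1 «VIRIAL HORN»,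
DIRECTOR-NS KEY-NS #210 (W-ii): the ALL-DEGREE BRACKET INJECTIVITY `bracketInjective_all` (= the hypothesis `hinj` of p712484
`windowWedgeAnalyticL_of_bracketInjective`, every `l ≥ 1`), by a kernel road that needs neither the `SO(3)`-isotypic decomposition of `Λ²𝓗_l`
nor a closed form of Legendre coefficients (ns-crc-p2 g10; `--supports stmt-NavierStokesRegularity-27585`, helper; 0 kit).

CONTENT.  ★ `exists_eq_sum_smul_Phi`: every `Δ̃`-harmonic homogeneous polynomial of degree `l` in `ℂ[W,V,Z]` is a combination
`Σ_{k ≤ 2l} c_k Φ_{l,k}` (descent on the top azimuthal weight with W1's one-dimensional harmonic weight slots `Zonal.slot_proportional`; the frame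
element `Φ_{l,l−μ}` is a non-zero harmonic slot of every weight `|μ| ≤ l`); bilinearity of `tripleC` over finite combinations
(`tripleC_sum_smul_sum_smul`); the BRACKET SUM `brSum l a = Σ_{j,k ≤ 2l} a_{jk} {Φ_{l,j}, Φ_{l,k}}` of an array; ★ EQUIVARIANCE
`raise (brSum l a) = brSum l (raiseArr l a)` (`raise_brSum`, from the raising laws of file 2); ★ `eval_iterate_lapC_brSum`:
`(Δ̃^i β(a))(1,0,0) = 2l² κ(l−1,i) · cert (2i+1) a` (the certificate table of file 3); consequence `cert_iterate_raiseArr_eq_zero`: an array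
with `brSum l a = 0` has vanishing certificates along its whole raising string.

HONEST LABEL: finite-dimensional polynomial algebra about solid harmonics (W1's complex-coordinate currency `Zonal.CPoly = ℂ[W,V,Z]`,
`tripleC = −i·det(∇·,∇·,x)`, `lapC`, imported by name — nothing is re-declared); no statement about Navier–Stokes solutions is made or
proved in this file; `UnthreadedRigidity` ⟨27585⟩, W2 and NS regularity remain OPEN.  [folklore]
-/

-- the summit and its single sub-problem share the name (CONVENTIONS §1)
set_option linter.dupNamespace false

noncomputable section

open MvPolynomial Finsupp

namespace Summit.NavierStokesRegularity.NavierStokesRegularity.Theorems.UnthreadedRigidity.VirialHorn.Coherent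

open Summit.NavierStokesRegularity.NavierStokesRegularity.Theorems.PoloidalLiouville.HorizonTower.Zonal
  (CPoly wt lapC lam tripleC dotC tri)

/-! ## E. Assembly: span, the bracket sum of an array, the complex theorem, the real theorem -/

section Span

open Summit.NavierStokesRegularity.NavierStokesRegularity.Theorems.PoloidalLiouville.HorizonTower.Zonal
  (WB eq_zero_of_WB_neg slot_proportional weight_le_degree isHomogeneous_wcomp wcomp_lapC)

/-- `Δ̃` of a difference. -/
theorem lapC_sub (P Q : CPoly) : lapC (P - Q) = lapC P - lapC Q := by
  simp only [lapC, map_sub]; ring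

/-- ★ THE COHERENT FRAME SPANS the harmonic homogeneous polynomials of degree `l` (descent on the top azimuthal weight:
harmonic weight slots are one-dimensional, W1's `slot_proportional`, and `Φ_{l,l−μ}` is a non-zero harmonic slot of every weight `|μ| ≤ l`). -/
theorem exists_eq_sum_smul_Phi {l : ℕ} {P : CPoly} (hP : P.IsHomogeneous l) (hPl : lapC P = 0) :
    ∃ c : ℕ → ℂ, P = ∑ k ∈ Finset.range (2 * l + 1), c k • Phi l k := by
  classical
  -- descent on the weight bound
  suffices h : ∀ n : ℕ, ∀ Q : CPoly, Q.IsHomogeneous l → lapC Q = 0 → WB ((n : ℤ) - l - 1) Q →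
      ∃ c : ℕ → ℂ, Q = ∑ k ∈ Finset.range (2 * l + 1), c k • Phi l k by
    exact h (2 * l + 1) P hP hPl (by
      have := WB.of_isHomogeneous hP
      convert this using 1; push_cast; ring)
  intro n
  induction n with
  | zero =>
    intro Q hQ _ hW
    refine ⟨fun _ => 0, ?_⟩
    rw [eq_zero_of_WB_neg hQ (by simpa using hW)]
    simp
  | succ n ih =>
    intro Q hQ hQl hW
    set β : ℤ := (n : ℤ) - l with hβ
    have hW' : WB β Q := by convert hW using 1; rw [hβ]; push_cast; ring
    by_cases hT : weightedHomogeneousComponent wt β Q = 0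
    · exact ih Q hQ hQl (by have := WB.of_wcomp_eq_zero hW' hT; convert this using 1)
    · -- the top component is a non-zero harmonic slot of weight `β`, hence a multiple of `Φ_{l, l−β}`
      set T := weightedHomogeneousComponent wt β Q with hT_def
      have hTw : IsWeightedHomogeneous wt T β := weightedHomogeneousComponent_isWeightedHomogeneous β Q
      have hTh : T.IsHomogeneous l := isHomogeneous_wcomp hQ β
      have hTl : lapC T = 0 := by rw [hT_def, ← wcomp_lapC, hQl, map_zero]
      obtain ⟨hlo, hhi⟩ := weight_le_degree hTw hTh hT
      obtain ⟨k₀, hk₀, hk₀β⟩ : ∃ k₀ : ℕ, k₀ < 2 * l + 1 ∧ ((l : ℤ) - k₀ = β) := ⟨(l - β).toNat, by omega, by omega⟩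
      have hΦw : IsWeightedHomogeneous wt (Phi l k₀) β := hk₀β ▸ isWeightedHomogeneous_Phi l k₀
      obtain ⟨c₀, hc₀⟩ := slot_proportional hΦw (isHomogeneous_Phi l k₀) (lapC_Phi l k₀) (Phi_ne_zero (by omega)) hTw hTh hTl
      -- subtract and descend
      have hQ' : (Q - T).IsHomogeneous l := hQ.sub hTh
      have hQ'l : lapC (Q - T) = 0 := by rw [lapC_sub, hQl, hTl, sub_zero]
      have hW'' : WB ((n : ℤ) - l - 1) (Q - T) := by
        have := WB.sub_wcomp hW'
        rw [← hT_def] at this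
        convert this using 1
      obtain ⟨c, hc⟩ := ih (Q - T) hQ' hQ'l hW''
      refine ⟨fun k => c k + if k = k₀ then c₀ else 0, ?_⟩
      calc Q = (Q - T) + T := by ring
        _ = (∑ k ∈ Finset.range (2 * l + 1), c k • Phi l k) + c₀ • Phi l k₀ := by rw [hc, hc₀, smul_eq_C_mul]
        _ = ∑ k ∈ Finset.range (2 * l + 1), (c k + if k = k₀ then c₀ else 0) • Phi l k := by
            simp only [add_smul, Finset.sum_add_distrib, ite_smul, zero_smul, Finset.sum_ite_eq', Finset.mem_range, if_pos hk₀]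

end Span

section BracketSum

open Summit.NavierStokesRegularity.NavierStokesRegularity.Theorems.PoloidalLiouville.HorizonTower.Zonal
  (tripleC_add_left tripleC_add_right tripleC_C_mul_right tripleC_swap tripleC_self)

/-- scalars in the left slot of the triple product. -/
theorem tripleC_smul_left (c : ℂ) (P Q : CPoly) : tripleC (c • P) Q = c • tripleC P Q := by
  rw [smul_eq_C_mul, smul_eq_C_mul, tripleC_swap, tripleC_C_mul_right, tripleC_swap]; ring

/-- scalars in the right slot of the triple product. -/
theorem tripleC_smul_right (c : ℂ) (P Q : CPoly) : tripleC P (c • Q) = c • tripleC P Q := by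
  rw [smul_eq_C_mul, smul_eq_C_mul, tripleC_C_mul_right]

/-- the triple product over finite sums (left). -/
theorem tripleC_sum_left {α : Type*} (s : Finset α) (P : α → CPoly) (Q : CPoly) :
    tripleC (∑ a ∈ s, P a) Q = ∑ a ∈ s, tripleC (P a) Q := by
  classical
  induction s using Finset.induction_on with
  | empty => simp [tripleC, Summit.NavierStokesRegularity.NavierStokesRegularity.Theorems.PoloidalLiouville.HorizonTower.Zonal.lam]
  | insert a s ha ih => rw [Finset.sum_insert ha, Finset.sum_insert ha, tripleC_add_left, ih]

/-- the triple product over finite sums (right). -/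
theorem tripleC_sum_right {α : Type*} (s : Finset α) (P : CPoly) (Q : α → CPoly) :
    tripleC P (∑ a ∈ s, Q a) = ∑ a ∈ s, tripleC P (Q a) := by
  classical
  induction s using Finset.induction_on with
  | empty => simp [tripleC, Summit.NavierStokesRegularity.NavierStokesRegularity.Theorems.PoloidalLiouville.HorizonTower.Zonal.lam]
  | insert a s ha ih => rw [Finset.sum_insert ha, Finset.sum_insert ha, tripleC_add_right, ih]

/-- BILINEAR EXPANSION of the triple product over two finite combinations. -/
theorem tripleC_sum_smul_sum_smul {α β : Type*} (s : Finset α) (t : Finset β) (c : α → ℂ) (d : β → ℂ)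
    (P : α → CPoly) (Q : β → CPoly) :
    tripleC (∑ a ∈ s, c a • P a) (∑ b ∈ t, d b • Q b) = ∑ a ∈ s, ∑ b ∈ t, (c a * d b) • tripleC (P a) (Q b) := by
  rw [tripleC_sum_left]
  refine Finset.sum_congr rfl fun a _ => ?_
  rw [tripleC_smul_left, tripleC_sum_right, Finset.smul_sum]
  refine Finset.sum_congr rfl fun b _ => ?_
  rw [tripleC_smul_right, smul_smul]

/-- the BRACKET SUM of a coefficient array over the coherent frame: `β(a) = Σ_{j,k ≤ 2l} a_{jk} {Φ_{l,j}, Φ_{l,k}}`. -/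
def brSum (l : ℕ) (a : ℕ → ℕ → ℂ) : CPoly :=
  ∑ j ∈ Finset.range (2 * l + 1), ∑ k ∈ Finset.range (2 * l + 1), a j k • tripleC (Phi l j) (Phi l k)

/-- `{0, Q} = 0`. -/
theorem tripleC_zero_left (Q : CPoly) : tripleC 0 Q = 0 := by
  simp [tripleC, Summit.NavierStokesRegularity.NavierStokesRegularity.Theorems.PoloidalLiouville.HorizonTower.Zonal.lam]

/-- `{P, 0} = 0`. -/
theorem tripleC_zero_right (P : CPoly) : tripleC P 0 = 0 := by
  simp [tripleC, Summit.NavierStokesRegularity.NavierStokesRegularity.Theorems.PoloidalLiouville.HorizonTower.Zonal.lam]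

/-- ★ EQUIVARIANCE: raising the bracket sum raises the array, `E β(a) = β(E a)`. -/
theorem raise_brSum (l : ℕ) (a : ℕ → ℕ → ℂ) : raise (brSum l a) = brSum l (raiseArr l a) := by
  have hL : ∀ k, ∑ j ∈ Finset.range (2 * l + 1), a j k • tripleC (raise (Phi l j)) (Phi l k)
      = ∑ j ∈ Finset.range (2 * l + 1), (((2 * l - j : ℕ) : ℂ) * a (j + 1) k) • tripleC (Phi l j) (Phi l k) := by
    intro k
    rw [Finset.sum_range_succ' (fun j => a j k • tripleC (raise (Phi l j)) (Phi l k)), raise_Phi_zero, tripleC_zero_left,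
      smul_zero, add_zero, Finset.sum_range_succ (fun j => (((2 * l - j : ℕ) : ℂ) * a (j + 1) k) • tripleC (Phi l j) (Phi l k)),
      Nat.sub_self, Nat.cast_zero, zero_mul, zero_smul, add_zero]
    refine Finset.sum_congr rfl fun j _ => ?_
    rw [raise_Phi_succ, tripleC_smul_left, smul_smul, mul_comm]
  have hR : ∀ j, ∑ k ∈ Finset.range (2 * l + 1), a j k • tripleC (Phi l j) (raise (Phi l k))
      = ∑ k ∈ Finset.range (2 * l + 1), (((2 * l - k : ℕ) : ℂ) * a j (k + 1)) • tripleC (Phi l j) (Phi l k) := by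
    intro j
    rw [Finset.sum_range_succ' (fun k => a j k • tripleC (Phi l j) (raise (Phi l k))), raise_Phi_zero, tripleC_zero_right,
      smul_zero, add_zero, Finset.sum_range_succ (fun k => (((2 * l - k : ℕ) : ℂ) * a j (k + 1)) • tripleC (Phi l j) (Phi l k)),
      Nat.sub_self, Nat.cast_zero, zero_mul, zero_smul, add_zero]
    refine Finset.sum_congr rfl fun k _ => ?_
    rw [raise_Phi_succ, tripleC_smul_right, smul_smul, mul_comm]
  unfold brSum
  simp only [raise_sum, raise_smul, raise_tripleC, smul_add, Finset.sum_add_distrib]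
  rw [Finset.sum_comm, Finset.sum_congr rfl fun k _ => hL k, Finset.sum_comm, Finset.sum_congr rfl fun j _ => hR j,
    ← Finset.sum_add_distrib]
  refine Finset.sum_congr rfl fun j _ => ?_
  rw [← Finset.sum_add_distrib]
  refine Finset.sum_congr rfl fun k _ => ?_
  rw [raiseArr, add_smul]

/-- iterated equivariance: `E^r β(a) = β(E^r a)`. -/
theorem iterate_raise_brSum (l : ℕ) (a : ℕ → ℕ → ℂ) (r : ℕ) : raise^[r] (brSum l a) = brSum l ((raiseArr l)^[r] a) := by
  induction r generalizing a with
  | zero => rfl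
  | succ r ih => rw [Function.iterate_succ_apply, Function.iterate_succ_apply, raise_brSum, ih]

/-- `E^r 0 = 0`. -/
theorem iterate_raise_zero (r : ℕ) : raise^[r] (0 : CPoly) = 0 := by
  induction r with
  | zero => rfl
  | succ r ih => rw [Function.iterate_succ_apply, raise_zero, ih]

/-- the Laplacian of `ℂ[W,V,Z]` as a linear map. -/
def lapL : CPoly →ₗ[ℂ] CPoly :=
  (C (4 : ℂ) : CPoly) • ((pderiv 0).toLinearMap ∘ₗ (pderiv 1).toLinearMap) + (pderiv 2).toLinearMap ∘ₗ (pderiv 2).toLinearMap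

/-- the linear map `lapL` is `Δ̃`. -/
theorem lapL_apply (P : CPoly) : lapL P = lapC P := by
  simp [lapL, lapC, smul_eq_mul]

/-- powers of `lapL` are iterates of `Δ̃`. -/
theorem lapL_pow_apply (i : ℕ) (P : CPoly) : (lapL ^ i) P = lapC^[i] P := by
  induction i generalizing P with
  | zero => rfl
  | succ i ih => rw [pow_succ, Module.End.mul_apply, lapL_apply, ih, Function.iterate_succ_apply]

/-- ★ THE CERTIFICATE OF A BRACKET SUM: `(Δ̃^i β(a))(1,0,0) = 2l² κ(l−1,i) · Λ_{2i+1}(a)` for `i + 1 ≤ l`. -/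
theorem eval_iterate_lapC_brSum {l i : ℕ} (hi : i + 1 ≤ l) (a : ℕ → ℕ → ℂ) :
    eval e0 (lapC^[i] (brSum l a)) = 2 * (l : ℂ) ^ 2 * ladder (l - 1) i * cert (2 * i + 1) a := by
  classical
  unfold brSum
  rw [← lapL_pow_apply, map_sum, map_sum]
  simp only [map_sum, map_smul, lapL_pow_apply, smul_eval, eval_iterate_lapC_tripleC_Phi hi, mul_ite, mul_zero]
  -- collapse the double sum onto the anti-diagonal `j + k = 2i + 1`
  have hinner : ∀ j ∈ Finset.range (2 * l + 1),
      (∑ k ∈ Finset.range (2 * l + 1),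
        if j + k = 2 * i + 1 then a j k * (2 * (l : ℂ) ^ 2 * ladder (l - 1) i * (-1) ^ j * ((2 * i + 1).choose j : ℂ)) else 0)
      = if j ≤ 2 * i + 1 then a j (2 * i + 1 - j) * (2 * (l : ℂ) ^ 2 * ladder (l - 1) i * (-1) ^ j * ((2 * i + 1).choose j : ℂ)) else 0 := by
    intro j _
    by_cases hj : j ≤ 2 * i + 1
    · rw [if_pos hj, Finset.sum_eq_single (2 * i + 1 - j)]
      · rw [if_pos (by omega)]
      · intro k _ hk; rw [if_neg (by omega)]
      · intro hk; exfalso; exact hk (Finset.mem_range.mpr (by omega))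
    · rw [if_neg hj]
      exact Finset.sum_eq_zero fun k _ => if_neg (by omega)
  rw [Finset.sum_congr rfl hinner, cert, Finset.mul_sum,
    ← Finset.sum_subset (Finset.range_mono (show 2 * i + 1 + 1 ≤ 2 * l + 1 by omega))]
  · refine Finset.sum_congr rfl fun j hj => ?_
    rw [if_pos (by have := Finset.mem_range.mp hj; omega)]
    ring
  · intro j _ hj
    rw [Finset.mem_range] at hj
    rw [if_neg (by omega)]

/-- consequence: a coefficient array with vanishing bracket sum has vanishing certificates along its whole raising string. -/
theorem cert_iterate_raiseArr_eq_zero {l : ℕ} (hl : 1 ≤ l) {a : ℕ → ℕ → ℂ} (ha : brSum l a = 0) (r N : ℕ) (hN : N % 2 = 1)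
    (hNl : N < 2 * l) : cert N ((raiseArr l)^[r] a) = 0 := by
  obtain ⟨i, rfl⟩ : ∃ i, N = 2 * i + 1 := ⟨N / 2, by omega⟩
  have hi : i + 1 ≤ l := by omega
  have h := eval_iterate_lapC_brSum hi ((raiseArr l)^[r] a)
  rw [← iterate_raise_brSum, ha, iterate_raise_zero, iterate_lapC_zero, map_zero] at h
  have hc : 2 * (l : ℂ) ^ 2 * ladder (l - 1) i ≠ 0 := by
    refine mul_ne_zero (mul_ne_zero two_ne_zero (pow_ne_zero _ ?_)) (ladder_ne_zero (by omega))
    exact_mod_cast (show l ≠ 0 by omega)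
  exact (mul_eq_zero.mp h.symm).resolve_left hc

end BracketSum

end Summit.NavierStokesRegularity.NavierStokesRegularity.Theorems.UnthreadedRigidity.VirialHorn.Coherent

end
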